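import Mathlib
import Literature.Combinatorics.Words.VanDerWaerdenCadences
import Literature.Combinatorics.HalesJewett.FiniteUnions
import HarnessLib

/-!
# Folkman's theorem (finite sums), finite form

R. L. Graham, B. L. Rothschild, J. H. Spencer, *Ramsey Theory* (2nd ed., Wiley 1990)
[GrahamRothschildSpencer1990], Chapter 3 "Equations", §3.4 "Finite sums and finite unions
(Folkman's theorem)" (pp. 81–83).  For a finite set `S` of positive integers the *sum-set* is
`𝒫(S) = {Σ_{s ∈ I} s : ∅ ≠ I ⊆ S}`; for a sequence `(a_i)` and a finite nonempty `I`,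
`a(I) = Σ_{i ∈ I} a_i`.  Third file of the Chapter 3 cluster (`RadoSingleEquation.lean`,
`RadoNonhomogeneousEquation.lean`).

PROVED here (theorems only), following the printed proofs:

* `exists_sums_coloured_by_max` — **Lemma 12** (p. 81): for all `c, k` there is `n = n(c, k)` such
  that every `c`-colouring has `a_0 < ⋯ < a_{k−1}`, all `a(I) ≤ n`, with the colour of `a(I)`
  depending only on `max I`.  Induction on `k` over van der Waerden's theorem (the tree's
  `Literature.Combinatorics.Words.vanDerWaerden`): `n(c, k+1) = 2W + 1`, `W = W(c, n(c,k) + 1)`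
  (the text's `2W(c, n(c,k))`, up to the indexing of `[W]` versus `{0, …, W}`).
* `folkman` — **Theorem 11 (Folkman's theorem; Folkman, Rado, Sanders)** in the finite form of
  p. 81 ("Folkman's Theorem (restatement)"): for all `c, k` there is `M = M(c, k)` such that every
  `c`-colouring has a `k`-set `A` of positive integers with `𝒫(A) ⊆ [1, M]` monochromatic; by the
  induced colour method and the pigeon-hole principle from Lemma 12.  The text takes
  `M = n(c, (c−1)k + 1)`; the pigeon-hole step needs `c(k−1) + 1` indices (with `(c−1)k + 1` it
  fails, e.g. `c = 2`, `k = 3`), and `M = n(c, c(k−1) + 1)` is used here.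
  `folkman_sumset_monochromatic` is Theorem 11 as first stated (arbitrarily large `S`).
* `folkman_of_finiteUnions` — the book's second route (pp. 82–83): `M(k, c) ≤ 2^{F(k, c)}` from the
  **Finite Unions Theorem (Theorem 13)** — the tree's
  `Literature.Combinatorics.HalesJewett.FiniteUnions.exists_monochromaticUnions` — through
  `φ(I) = Σ_{i ∈ I} 2^i` (Mathlib's `Finset.equivBitIndices`), under which disjoint union
  corresponds to addition.

Not treated here: the converse deduction of Theorem 13 from Theorem 11 and the direct proof of
Theorem 13 (pp. 83–84); §3.5 (Hindman's theorem — Mathlib's `Hindman.exists_FS_of_finite_cover`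
is the infinite form).

## References

* [GrahamRothschildSpencer1990] R. L. Graham, B. L. Rothschild, J. H. Spencer, *Ramsey Theory*,
  2nd ed., Wiley (1990), Ch. 3 §3.4, Theorem 11, Lemma 12, Theorem 13 (held text
  `book:graham1990-ramsey-theory`, chunks 73–74).
* [Lothaire1997] M. Lothaire, *Combinatorics on Words*, Theorem 3.1.3 (van der Waerden) — tree file
  `Literature/Combinatorics/Words/VanDerWaerdenCadences.lean`.
* [Promel2013] H. J. Prömel, *Ramsey Theory for Discrete Structures*, Thm 5.7 (finite union
  theorem) — tree file `Literature/Combinatorics/HalesJewett/FiniteUnions.lean`.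
-/

namespace Literature.Combinatorics.Additive

open Finset

section Lemma12

/-- **Lemma 12**: for every finite set of colours and every `k` there is `n = n(c, k)` such that
every colouring of `ℕ` admits `a_0 < a_1 < ⋯ < a_{k-1}`, positive, with all subset sums
`a(I) = Σ_{i ∈ I} a_i ≤ n` (`∅ ≠ I ⊆ {0, …, k-1}`) and the colour of `a(I)` depending only on
`max I` (namely equal to the colour of `a_{max I}`).  Induction on `k` over van der Waerden's
theorem: `n(c, k+1) = 2W + 1` where `W = W(c, n(c,k) + 1)`; a monochromatic progression
`{a_k + λd : 0 ≤ λ ≤ n(c, k)}` inside `(W, 2W + 1]` and, "identifying `d[n(c,k)]` with `[n(c,k)]`",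
the induction hypothesis for the colouring `x ↦ χ(dx)`.
[cite: GrahamRothschildSpencer1990, Ch. 3 §3.4, Lemma 12 (pp. 81–82)] -/
theorem exists_sums_coloured_by_max (κ : Type*) [Finite κ] (k : ℕ) :
    ∃ n : ℕ, ∀ χ : ℕ → κ, ∃ a : ℕ → ℕ, (∀ i j, i < j → j < k → a i < a j) ∧ (∀ i < k, 0 < a i) ∧
      ∀ I : Finset ℕ, I ⊆ Finset.range k → ∀ hI : I.Nonempty,
        ∑ i ∈ I, a i ≤ n ∧ χ (∑ i ∈ I, a i) = χ (a (I.max' hI)) := by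
  induction k with
  | zero =>
    refine ⟨0, fun χ => ⟨fun _ => 0, fun i j _ hj => absurd hj (Nat.not_lt_zero _),
      fun i hi => absurd hi (Nat.not_lt_zero _), fun I hI hne => ?_⟩⟩
    rw [Finset.range_zero, Finset.subset_empty] at hI
    exact absurd hI hne.ne_empty
  | succ k ih =>
    obtain ⟨nk, hnk⟩ := ih
    obtain ⟨W, hW⟩ := Literature.Combinatorics.Words.vanDerWaerden κ (nk + 1)
    refine ⟨2 * W + 1, fun χ => ?_⟩
    -- a monochromatic progression `top + λ d`, `0 ≤ λ ≤ nk`, with `top > W ≥ nk d`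
    obtain ⟨a₀, d, hd, hbd, hmono⟩ := hW (fun x => χ (x + W + 1))
    simp only [Nat.add_sub_cancel] at hbd
    have hbd' : a₀ + d * nk ≤ W := by rw [mul_comm]; exact hbd
    have hdn : d * nk ≤ W := le_trans (Nat.le_add_left _ _) hbd'
    obtain ⟨top, htop⟩ : ∃ t : ℕ, t = a₀ + W + 1 := ⟨_, rfl⟩
    have hmono' : ∀ l ≤ nk, χ (top + l * d) = χ top := by
      intro l hl
      rw [htop, show a₀ + W + 1 + l * d = a₀ + l * d + W + 1 by ring]
      exact hmono l (Nat.lt_succ_of_le hl)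
    -- the induction hypothesis for the colouring `x ↦ χ (d x)`
    obtain ⟨b, hbmono, hbpos, hb⟩ := hnk (fun x => χ (d * x))
    have hble : ∀ i < k, b i ≤ nk := by
      intro i hi
      have := (hb {i} (by simpa using hi) (Finset.singleton_nonempty i)).1
      simpa using this
    refine ⟨fun i => if i < k then d * b i else top, ?_, ?_, ?_⟩
    · -- strictly increasing
      intro i j hij hj
      by_cases hjk : j < k
      · have hik : i < k := lt_trans hij hjk
        simp only [hik, hjk, if_true]
        exact Nat.mul_lt_mul_of_pos_left (hbmono i j hij hjk) hd
      · have hik : i < k := by omega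
        simp only [hik, hjk, if_true, if_false]
        have h1 : d * b i ≤ d * nk := Nat.mul_le_mul_left _ (hble i hik)
        rw [htop]; omega
    · -- positive
      intro i hi
      by_cases hik : i < k
      · simp only [hik, if_true]; exact Nat.mul_pos hd (hbpos i hik)
      · simp only [hik, if_false]; rw [htop]; omega
    · -- subset sums
      intro I hI hne
      show ∑ i ∈ I, (if i < k then d * b i else top) ≤ 2 * W + 1 ∧
        χ (∑ i ∈ I, (if i < k then d * b i else top)) =
          χ (if I.max' hne < k then d * b (I.max' hne) else top)
      -- split off the top index `k`
      have hIlt : ∀ i ∈ I, i < k + 1 := fun i hi => Finset.mem_range.mp (hI hi)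
      set I' : Finset ℕ := I.filter (fun i => i < k) with hI'
      have hI'sub : I' ⊆ Finset.range k := fun i hi => by
        rw [hI', Finset.mem_filter] at hi; exact Finset.mem_range.mpr hi.2
      have hsumI' : ∑ i ∈ I', (if i < k then d * b i else top) = d * ∑ i ∈ I', b i := by
        rw [Finset.mul_sum]
        refine Finset.sum_congr rfl fun i hi => ?_
        rw [hI', Finset.mem_filter] at hi
        rw [if_pos hi.2]
      have hlam : ∑ i ∈ I', b i ≤ nk := by
        rcases I'.eq_empty_or_nonempty with h | h
        · rw [h, Finset.sum_empty]; exact Nat.zero_le _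
        · exact (hb I' hI'sub h).1
      have hdlam' : d * ∑ i ∈ I', b i ≤ d * nk := Nat.mul_le_mul_left _ hlam
      have hdlam : d * ∑ i ∈ I', b i ≤ W := le_trans hdlam' hdn
      by_cases hk : k ∈ I
      · -- `max I = k` and `a(I) = top + λ d`
        have hmax : I.max' hne = k :=
          le_antisymm (Finset.max'_le _ _ _ fun i hi => Nat.le_of_lt_succ (hIlt i hi))
            (Finset.le_max' _ _ hk)
        have hrest : I.filter (fun i => ¬ i < k) = {k} := by
          ext i
          simp only [Finset.mem_filter, Finset.mem_singleton, not_lt]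
          constructor
          · rintro ⟨hi, hki⟩; have := hIlt i hi; omega
          · rintro rfl; exact ⟨hk, le_rfl⟩
        have hsum : ∑ i ∈ I, (if i < k then d * b i else top) = top + d * ∑ i ∈ I', b i := by
          rw [← Finset.sum_filter_add_sum_filter_not I (fun i => i < k), hsumI', hrest,
            Finset.sum_singleton, if_neg (lt_irrefl k), add_comm]
        rw [hsum, hmax]
        simp only [lt_irrefl, if_false]
        refine ⟨by rw [htop]; omega, ?_⟩
        rw [mul_comm]
        exact hmono' _ hlam
      · -- `I ⊆ {0, …, k-1}`: the induction hypothesis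
        have hIk : I ⊆ Finset.range k := fun i hi => by
          have h1 := hIlt i hi
          have h2 : i ≠ k := fun h => hk (h ▸ hi)
          exact Finset.mem_range.mpr (by omega)
        have hII' : I' = I := by
          rw [hI']; exact Finset.filter_true_of_mem fun i hi => Finset.mem_range.mp (hIk hi)
        rw [hII'] at hsumI' hlam hdlam hdlam'
        obtain ⟨-, hcol⟩ := hb I hIk hne
        have hmaxlt : I.max' hne < k := Finset.mem_range.mp (hIk (Finset.max'_mem _ _))
        rw [hsumI']
        simp only [hmaxlt, if_true]
        exact ⟨by omega, hcol⟩

end Lemma12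

section Folkman

/-- **Theorem 11 (Folkman's theorem — Folkman, Rado, Sanders), finite form**: for every finite set
of colours and every `k` there is `M = M(c, k)` such that every colouring of `ℕ` admits a set `A`
of `k` positive integers whose sum-set `𝒫(A) = {Σ_{a ∈ I} a : ∅ ≠ I ⊆ A}` lies in `[1, M]` and is
monochromatic.  Printed proof (the "induced colour method"): take `a_0 < ⋯ < a_{K-1}` from Lemma 12
with `K = c(k−1) + 1` (the text prints `(c−1)k + 1`, which is too small for the pigeon-hole step;
`c(k−1) + 1` is what the argument uses), colour `i < K` by the common colour of the `a(I)` with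
`max I = i`, and take `k` indices of one induced colour.  (Mathlib's `Hindman.exists_FS_of_finite_cover`
is the infinite relative, Hindman's theorem of §3.5.)
[cite: GrahamRothschildSpencer1990, Ch. 3 §3.4, Theorem 11 and its restatement (pp. 81–82)] -/
theorem folkman (κ : Type*) [Finite κ] (k : ℕ) :
    ∃ M : ℕ, ∀ χ : ℕ → κ, ∃ A : Finset ℕ, A.card = k ∧ (∀ a ∈ A, 0 < a) ∧
      ∃ c : κ, ∀ I ⊆ A, I.Nonempty → ∑ a ∈ I, a ≤ M ∧ χ (∑ a ∈ I, a) = c := by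
  classical
  haveI := Fintype.ofFinite κ
  set K : ℕ := Fintype.card κ * (k - 1) + 1 with hK
  obtain ⟨n, hn⟩ := exists_sums_coloured_by_max κ K
  refine ⟨n, fun χ => ?_⟩
  rcases isEmpty_or_nonempty κ with hκ | hκ
  · exact isEmptyElim (χ 0)
  obtain ⟨a, hamono, hapos, ha⟩ := hn χ
  -- the induced colouring `i ↦ χ (a i)` of `{0, …, K-1}` and a popular colour
  obtain ⟨c, -, hc⟩ := Finset.exists_lt_card_fiber_of_mul_lt_card_of_maps_to
    (s := Finset.range K) (t := (Finset.univ : Finset κ)) (f := fun i => χ (a i)) (n := k - 1)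
    (fun _ _ => Finset.mem_univ _) (by rw [Finset.card_univ, Finset.card_range, hK]; omega)
  obtain ⟨S, hSsub, hScard⟩ := Finset.exists_subset_card_eq (s := (Finset.range K).filter
    (fun i => χ (a i) = c)) (n := k) (by omega)
  have hSK : ∀ i ∈ S, i < K := fun i hi =>
    Finset.mem_range.mp (Finset.mem_of_mem_filter i (hSsub hi))
  have hSc : ∀ i ∈ S, χ (a i) = c := fun i hi => (Finset.mem_filter.mp (hSsub hi)).2
  have hinj : Set.InjOn a S := by
    intro i hi j hj hij
    by_contra hne
    rcases lt_or_gt_of_ne hne with h | h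
    · exact absurd hij (hamono i j h (hSK j hj)).ne
    · exact absurd hij (hamono j i h (hSK i hi)).ne'
  refine ⟨S.image a, by rw [Finset.card_image_of_injOn hinj, hScard], fun x hx => ?_, c,
    fun I hI hne => ?_⟩
  · obtain ⟨i, hi, rfl⟩ := Finset.mem_image.mp hx
    exact hapos i (hSK i hi)
  · -- `I = a(J)` for `J = {j ∈ S : a j ∈ I}`
    set J : Finset ℕ := S.filter (fun j => a j ∈ I) with hJ
    have hIJ : I = J.image a := by
      ext x
      simp only [hJ, Finset.mem_image, Finset.mem_filter]
      constructor
      · intro hx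
        obtain ⟨i, hi, rfl⟩ := Finset.mem_image.mp (hI hx)
        exact ⟨i, ⟨hi, hx⟩, rfl⟩
      · rintro ⟨i, ⟨-, hi⟩, rfl⟩; exact hi
    have hJS : J ⊆ S := Finset.filter_subset _ _
    have hJne : J.Nonempty := by
      obtain ⟨x, hx⟩ := hne
      rw [hIJ] at hx
      obtain ⟨j, hj, -⟩ := Finset.mem_image.mp hx
      exact ⟨j, hj⟩
    have hsum : ∑ x ∈ I, x = ∑ j ∈ J, a j := by
      rw [hIJ, Finset.sum_image fun i hi j hj h => hinj (hJS hi) (hJS hj) h]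
    obtain ⟨hle, hcol⟩ := ha J (fun j hj => Finset.mem_range.mpr (hSK j (hJS hj))) hJne
    rw [hsum, hcol]
    exact ⟨hle, hSc _ (hJS (Finset.max'_mem _ _))⟩

/-- **Theorem 11 (Folkman's theorem)**, as printed: if `ℕ` is finitely coloured there are
arbitrarily large finite sets `S` of positive integers with `𝒫(S)` monochromatic.
[cite: GrahamRothschildSpencer1990, Ch. 3 §3.4, Theorem 11 (p. 81)] -/
theorem folkman_sumset_monochromatic {κ : Type*} [Finite κ] (χ : ℕ → κ) (k : ℕ) :
    ∃ A : Finset ℕ, A.card = k ∧ (∀ a ∈ A, 0 < a) ∧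
      ∃ c : κ, ∀ I ⊆ A, I.Nonempty → χ (∑ a ∈ I, a) = c := by
  obtain ⟨M, hM⟩ := folkman κ k
  obtain ⟨A, hA, hpos, c, hc⟩ := hM χ
  exact ⟨A, hA, hpos, c, fun I hI hne => (hc I hI hne).2⟩

/-- **Folkman's theorem from the Finite Unions Theorem** (`M(k, c) ≤ 2^{F(k,c)}`): under
`φ(I) = Σ_{i ∈ I} 2^i`, union of disjoint sets corresponds to addition, so a disjoint collection
`𝒟` of `k` blocks with `FU(𝒟)` monochromatic for the colouring `I ↦ χ(φ(I))` gives a `k`-set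
`A = φ(𝒟) ⊆ [1, 2^F)` with monochromatic sum-set.  The Finite Unions Theorem is the tree's
`Literature.Combinatorics.HalesJewett.FiniteUnions.exists_monochromaticUnions`.
[cite: GrahamRothschildSpencer1990, Ch. 3 §3.4, Theorem 13 and the deduction of Theorem 11 from it
(pp. 82–83)] -/
theorem folkman_of_finiteUnions (κ : Type*) [Finite κ] (k : ℕ) :
    ∃ F : ℕ, ∀ χ : ℕ → κ, ∃ A : Finset ℕ, A.card = k ∧ (∀ a ∈ A, 0 < a ∧ a < 2 ^ F) ∧
      ∃ c : κ, ∀ I ⊆ A, I.Nonempty → χ (∑ a ∈ I, a) = c := by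
  classical
  obtain ⟨D, hD⟩ := Literature.Combinatorics.HalesJewett.FiniteUnions.exists_monochromaticUnions κ k
  refine ⟨D, fun χ => ?_⟩
  -- `φ(U) = Σ_{i ∈ U} 2^i`
  set φ : Finset (Fin D) → ℕ := fun U => ∑ i ∈ U, 2 ^ (i : ℕ) with hφ
  have hφmap : ∀ U : Finset (Fin D), φ U = ∑ i ∈ U.map Fin.valEmbedding, 2 ^ i := fun U => by
    rw [hφ, Finset.sum_map]; rfl
  have hφinj : Function.Injective φ := by
    intro U V hUV
    rw [hφmap, hφmap, ← Finset.equivBitIndices_symm_apply, ← Finset.equivBitIndices_symm_apply]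
      at hUV
    exact Finset.map_injective _ (Finset.equivBitIndices.symm.injective hUV)
  have hφlt : ∀ U : Finset (Fin D), φ U < 2 ^ D := fun U => by
    rw [hφmap]
    calc ∑ i ∈ U.map Fin.valEmbedding, 2 ^ i ≤ ∑ i ∈ Finset.range D, 2 ^ i :=
          Finset.sum_le_sum_of_subset_of_nonneg (fun i hi => by
            obtain ⟨j, -, rfl⟩ := Finset.mem_map.mp hi
            exact Finset.mem_range.mpr j.isLt) fun _ _ _ => Nat.zero_le _
      _ < 2 ^ D := by
          rw [Nat.geomSum_eq le_rfl D, show (2 : ℕ) - 1 = 1 from rfl, Nat.div_one]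
          exact Nat.sub_lt (Nat.two_pow_pos D) one_pos
  have hφpos : ∀ U : Finset (Fin D), U.Nonempty → 0 < φ U := fun U hU => by
    rw [hφ]; exact Finset.sum_pos (fun i _ => Nat.two_pow_pos _) hU
  obtain ⟨E, hEne, hEdisj, c, hc⟩ := hD (fun U => χ (φ U))
  have hEinj : Function.Injective E := by
    intro i j hij
    by_contra hne
    have := hEdisj i j hne
    rw [hij, disjoint_self, Finset.bot_eq_empty] at this
    exact (hEne j).ne_empty this
  have hinj : Function.Injective (φ ∘ E) := hφinj.comp hEinj
  refine ⟨Finset.univ.image (φ ∘ E), by rw [Finset.card_image_of_injective _ hinj,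
    Finset.card_univ, Fintype.card_fin], fun x hx => ?_, c, fun I hI hne => ?_⟩
  · obtain ⟨j, -, rfl⟩ := Finset.mem_image.mp hx
    exact ⟨hφpos _ (hEne j), hφlt _⟩
  · set J : Finset (Fin k) := Finset.univ.filter (fun j => φ (E j) ∈ I) with hJ
    have hIJ : I = J.image (φ ∘ E) := by
      ext x
      simp only [hJ, Finset.mem_image, Finset.mem_filter, Finset.mem_univ, true_and,
        Function.comp_apply]
      constructor
      · intro hx
        obtain ⟨j, -, rfl⟩ := Finset.mem_image.mp (hI hx)
        exact ⟨j, hx, rfl⟩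
      · rintro ⟨j, hj, rfl⟩; exact hj
    have hJne : J.Nonempty := by
      obtain ⟨x, hx⟩ := hne
      rw [hIJ] at hx
      obtain ⟨j, hj, -⟩ := Finset.mem_image.mp hx
      exact ⟨j, hj⟩
    have hsum : ∑ x ∈ I, x = φ (J.biUnion E) := by
      rw [hIJ, Finset.sum_image fun i _ j _ h => hinj h]
      simp only [Function.comp_apply, hφ]
      rw [Finset.sum_biUnion fun i _ j _ hij => hEdisj i j hij]
    rw [hsum]
    exact hc J hJne

end Folkman

end Literature.Combinatorics.Additive
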